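import Literature.NumberTheory.Transcendental.KZSemiCanonicalReductionProofs
import Literature.NumberTheory.Transcendental.SemialgebraicMapsProofs

/-!
# Route ValuedFieldSpecialisation — crux `ParametricLifting` (stmt-KontsevichZagierPeriods-3498):
merging two integral representations INSIDE a positive dimension

Helper (`--supports`) for item stmt-KontsevichZagierPeriods-3498 (line `registered`, lead c8; lead c7's
recommendation 1: the dimension-PRESERVING merge). The calculus of moves
(`Literature.NumberTheory.Transcendental.KZ`) merges two representations only one dimension UP
(`KZ.IntegralRep.exists_of_add_of_sub_of_mem_relations`: slabs at disjoint levels), inside dimension one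
(`Summit.KontsevichZagierPeriods.ComplexOrientations.OrientationKernel.exists_add_sub_mem_relations_one`)
or for bounded volumes (`KZ.exists_merge₂`). This file proves the same-dimension merge in EVERY positive
dimension and for ARBITRARY representations (unbounded domains, e.g. all of `ℝⁿ⁺¹`, are allowed):

* `exists_chartPiece` — rule (2) along the involutive chart `PeriodCompactify.inv T` (inversion of the
  coordinates in `T`) from the bounded piece domain `pieceDom T σ ⊆ [-1, 1]ⁿ` onto the trace
  `σ ∩ outer T`, for a GENERAL `ℚ`-semialgebraic integrand `f`: the charted integrand
  `v ↦ f (inv T v) · |det D(inv T)(v)|` is semialgebraic (composition and product of semialgebraic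
  functions, Tarski–Seidenberg) and absolutely integrable (Mathlib's Jacobian formula);
* `exists_sub_sum_isBounded_mem_relations` — Viu-Sos' compactification by charts of the projective
  line at the level of moves, for general integrands: `[σ, f] ≡ ∑_T [pieceDom T σ, f ∘ inv T · Jac]`
  (rule (1) along the outer regions, whose union has null complement, then rule (2) piecewise) —
  the rational-integrand case being the tree's `KZ.exists_sub_sum_bounded_mem_relations`;
* `exists_merge₂_isBounded`, `exists_merge_isBounded` — two, resp. finitely many, representations of
  dimension `n + 1` with BOUNDED domains merge into one (translate along the first coordinate by a
  rational vector, rule (2), and glue disjoint domains, rule (1)) — `KZ.exists_merge₂` without the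
  restriction to integrand `1`;
* `exists_isBounded_sub_mem_relations_succ` — bounded normal form: every representation of dimension
  `n + 1` is `≡` one representation with bounded domain;
* `stub_sameDimMerge` — `∀ n (a b : KZ.IntegralRep (n + 1)), ∃ c, [a] + [b] − [c] ∈ KZ.relations`.

It makes the kernel form and the pair form of the graded period conjecture agree at matching levels.
Only proved tree API is used (rules (1), (2) and their packaged forms, the charts of
`PeriodCompactDomain.lean`, the discharged Tarski–Seidenberg facts of `SemialgebraicMapsProofs.lean`);
no definition, no named fact, no transcendence input.

Sources: M. Kontsevich, D. Zagier, *Periods* (2001), §1.2, rules (1)–(2); J. Viu-Sos, *A semi-canonical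
reduction for periods of Kontsevich–Zagier*, Int. J. Number Theory 17 (2021), Thm. 2.1 (compactification
of the domain by charts of the projective line) and Cor. 2.3 (disjoint translates).
-/

noncomputable section

namespace Summit.KontsevichZagierPeriods.ValuedFieldSpecialisation

open Set MeasureTheory
open Literature.NumberTheory.Transcendental Literature.ModelTheory.ExponentialFields
open Literature.NumberTheory.Transcendental.PeriodCompactify

/-- **The chart of one compactified piece, for a general integrand** (rule (2)). For a representation
`a = (σ, f)` of dimension `N` and `T ⊆ Fin N` there is a representation `R` with domain the bounded
piece domain `pieceDom T σ = inner T ∩ (inv T)⁻¹ σ ⊆ [-1, 1]ᴺ` and integrand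
`v ↦ f (inv T v) · |det D(inv T)(v)|` (semialgebraic by composition with the rational chart and
multiplication by the rational Jacobian `∏_{i ∈ T} vᵢ⁻²`; integrable by the Jacobian formula, `inv T`
being an involution of `pieceDom T σ` onto `σ ∩ outer T`), and `[R] − [σ ∩ outer T, f]` is ONE
change-of-variables move along `inv T`.
[cite: ViuSos2021, Thm. 2.1] -/
theorem exists_chartPiece {N : ℕ} (a : KZ.IntegralRep N) (T : Finset (Fin N)) :
    ∃ R : KZ.IntegralRep N, R.domain = pieceDom T a.domain ∧
      KZ.of R - KZ.of (a.restrict (a.domain ∩ outer T)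
        (a.isSemialgebraic_domain.inter (isSemialgebraic_outer T)) inter_subset_left) ∈
        KZ.changeOfVariablesRel := by
  have hσ : IsSemialgebraic ℚ a.domain := a.isSemialgebraic_domain
  have hD : IsSemialgebraic ℚ (pieceDom T a.domain) := isSemialgebraic_pieceDom T hσ
  -- the charted integrand is semialgebraic
  have hcomp : IsSemialgebraicFunOn ℚ (pieceDom T a.domain) (fun v => a.integrand (inv T v)) :=
    IsSemialgebraicFunOn.comp_isSemialgebraicMapOn_holds a.isSemialgebraicFunOn_integrand
      (KZ.isSemialgebraicMapOn_inv_pieceDom T hσ) fun _ hv => hv.2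
  have hjac : IsSemialgebraicFunOn ℚ (pieceDom T a.domain) (fun v => |(invDeriv T v).det|) := by
    refine (isSemialgebraicFunOn_aeval_div_aeval hD (1 : MvPolynomial (Fin N) ℚ)
      (∏ i ∈ T, MvPolynomial.X i ^ 2) fun v hv => ?_).congr fun v _ => ?_
    · rw [aeval_prod_X_sq T v]
      exact prod_pow_ne_zero T fun i hi => ne_zero_of_mem_inner T hv.1 hi
    · dsimp only
      rw [abs_det_invDeriv, map_one, aeval_prod_X_sq T v, Finset.prod_inv_distrib, one_div]
  have hfun : IsSemialgebraicFunOn ℚ (pieceDom T a.domain)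
      (fun v => a.integrand (inv T v) * |(invDeriv T v).det|) :=
    IsSemialgebraicFunOn.mul_holds hcomp hjac
  -- and absolutely integrable (Jacobian formula for the involution `inv T`)
  have hint : IntegrableOn (fun v => a.integrand (inv T v) * |(invDeriv T v).det|)
      (pieceDom T a.domain) := by
    have h := (integrableOn_image_iff_integrableOn_abs_det_fderiv_smul volume
      (measurableSet_pieceDom T hσ) (hasFDerivWithinAt_inv_pieceDom T) (injOn_inv_pieceDom T)
      a.integrand).1 (by
        rw [image_inv_pieceDom]
        exact a.integrableOn.mono_set inter_subset_left)
    refine h.congr_fun (fun v _ => ?_) (measurableSet_pieceDom T hσ)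
    simp only [smul_eq_mul, mul_comm]
  let R : KZ.IntegralRep N := ⟨_, _, hD, hfun, hint⟩
  set S : KZ.IntegralRep N := a.restrict (a.domain ∩ outer T)
    (a.isSemialgebraic_domain.inter (isSemialgebraic_outer T)) inter_subset_left
  refine ⟨R, rfl, ?_⟩
  exact ⟨N, R, S, inv T, invDeriv T, KZ.isSemialgebraicMapOn_inv_pieceDom T hσ,
    hasFDerivWithinAt_inv_pieceDom T, injOn_inv_pieceDom T, (image_inv_pieceDom T).symm,
    fun v _ => rfl, rfl⟩

/-- **Compactification of the domain at the level of moves, general integrand** [Viu-Sos 2021,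
Thm. 2.1 / Cor. 2.1]. Every representation `a = (σ, f)` of dimension `N` differs by relations from the
sum of `2ᴺ` representations with BOUNDED domains (inside `[-1, 1]ᴺ`): split `σ` along the outer regions
`outer T`, `T ⊆ Fin N` (rule (1); they are pairwise disjoint and the complement of their union is the
null set `⋃ᵢ {|yᵢ| = 1}`), and change variables on each trace by the involutive chart `inv T`
(rule (2), `exists_chartPiece`). The rational-integrand case is the tree's
`KZ.exists_sub_sum_bounded_mem_relations`. [cite: ViuSos2021, Thm. 2.1] -/
theorem exists_sub_sum_isBounded_mem_relations {N : ℕ} (a : KZ.IntegralRep N) :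
    ∃ R : Finset (Fin N) → KZ.IntegralRep N,
      (∀ T, Bornology.IsBounded (R T).domain) ∧ KZ.of a - ∑ T, KZ.of (R T) ∈ KZ.relations := by
  have hσ : IsSemialgebraic ℚ a.domain := a.isSemialgebraic_domain
  choose R hRd hmove using fun T => exists_chartPiece a T
  refine ⟨R, fun T => ?_, ?_⟩
  · rw [hRd]
    exact isBounded_pieceDom T
  -- the traces of `a` on the outer regions
  set S : Finset (Fin N) → KZ.IntegralRep N := fun T => a.restrict (a.domain ∩ outer T)
    (a.isSemialgebraic_domain.inter (isSemialgebraic_outer T)) inter_subset_left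
  have e1 : KZ.of a - ∑ T, KZ.of (S T) ∈ KZ.relations := by
    refine KZ.of_sub_sum_of_mem_relations Finset.univ a S (fun T _ => ?_) (fun T _ _ _ => rfl) ?_ ?_
    · rw [show (S T).domain \ a.domain = ∅ from sdiff_eq_empty.mpr inter_subset_left, measure_empty]
    · refine measure_mono_null (fun x hx => ?_) volume_compl_iUnion_outer
      intro hx'
      obtain ⟨T, hT⟩ := mem_iUnion.1 hx'
      exact hx.2 (mem_biUnion (Finset.mem_univ T) ⟨hx.1, hT⟩)
    · intro T hT T' hT' hne
      rw [show (S T).domain ∩ (S T').domain = ∅ from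
        Set.disjoint_iff_inter_eq_empty.mp (pairwiseDisjoint_outer a.domain hT hT' hne), measure_empty]
  -- each chart is a change-of-variables move
  have e3 := KZ.sum_sub_sum_mem_relations Finset.univ _ _ fun T _ =>
    KZ.changeOfVariablesRel_subset_relations (hmove T)
  have : KZ.of a - ∑ T, KZ.of (R T) =
      (KZ.of a - ∑ T, KZ.of (S T)) - (∑ T, KZ.of (R T) - ∑ T, KZ.of (S T)) := by
    abel
  rw [this]
  exact KZ.relations.sub_mem e1 e3

/-- **Two representations with bounded domains merge inside dimension `n + 1`**: translate the second
along the first coordinate beyond a box containing both (rule (2), `KZ.exists_translate` by the rational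
vector `(2R₀, 0, …, 0)`) and glue the two now disjoint domains by domain additivity (rule (1)). This is
`KZ.exists_merge₂` without the restriction to integrand `1`.
[cite: ViuSos2021, Cor. 2.3] -/
theorem exists_merge₂_isBounded {n : ℕ} (A B : KZ.IntegralRep (n + 1))
    (hA : Bornology.IsBounded A.domain) (hB : Bornology.IsBounded B.domain) :
    ∃ K : KZ.IntegralRep (n + 1), Bornology.IsBounded K.domain ∧
      KZ.of A + KZ.of B - KZ.of K ∈ KZ.relations := by
  obtain ⟨C, hC⟩ := isBounded_iff_forall_norm_le.mp (hA.union hB)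
  set R₀ : ℕ := ⌈C⌉₊ + 1 with hR₀
  have hCR : C < R₀ := by
    rw [hR₀, Nat.cast_add, Nat.cast_one]
    exact (Nat.le_ceil C).trans_lt (lt_add_one _)
  set v : Fin (n + 1) → ℚ := fun i => if i = 0 then 2 * (R₀ : ℚ) else 0 with hv
  obtain ⟨B', hB'd, -, hrel⟩ := KZ.exists_translate B v
  have hw0 : ((v 0 : ℚ) : ℝ) = 2 * R₀ := by simp [hv]
  have hwle : ∀ i, |((v i : ℚ) : ℝ)| ≤ 2 * R₀ := fun i => by
    by_cases hi : i = 0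
    · simp [hv, hi]
    · simp [hv, hi]
  have hB'b : Bornology.IsBounded B'.domain := by
    refine isBounded_iff_forall_norm_le.mpr ⟨C + 2 * R₀, fun z hz => ?_⟩
    rw [hB'd] at hz
    have hzC := hC _ (Or.inr hz)
    have hC0 : 0 ≤ C := (norm_nonneg _).trans hzC
    refine (pi_norm_le_iff_of_nonneg (by positivity)).mpr fun i => ?_
    have h1 : |z i - (v i : ℝ)| ≤ C := by
      simpa [Real.norm_eq_abs] using (norm_le_pi_norm (z - fun i => (v i : ℝ)) i).trans hzC
    rw [Real.norm_eq_abs]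
    have h2 := hwle i
    rw [abs_le] at h1 h2 ⊢
    constructor <;> linarith
  have hdisj : Disjoint A.domain B'.domain := by
    rw [Set.disjoint_left]
    intro z hzA hzB
    rw [hB'd] at hzB
    have h1 : |z 0| ≤ C := by
      simpa [Real.norm_eq_abs] using (norm_le_pi_norm z 0).trans (hC z (Or.inl hzA))
    have h2 : |z 0 - 2 * R₀| ≤ C := by
      have := (norm_le_pi_norm (z - fun i => (v i : ℝ)) 0).trans (hC _ (Or.inr hzB))
      simpa [Real.norm_eq_abs, hw0] using this
    rw [abs_le] at h1 h2
    linarith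
  refine ⟨A.glue B' hdisj, hA.union hB'b, ?_⟩
  have h1 := KZ.domainAddRel_subset_relations
    (KZ.IntegralRep.of_glue_sub_sub_mem_domainAddRel A B' hdisj)
  have h2 := KZ.changeOfVariablesRel_subset_relations hrel
  have : KZ.of A + KZ.of B - KZ.of (A.glue B' hdisj) =
      (KZ.of B - KZ.of B') - (KZ.of (A.glue B' hdisj) - KZ.of A - KZ.of B') := by
    abel
  rw [this]
  exact KZ.relations.sub_mem h2 h1

/-- **Finitely many representations with bounded domains merge inside dimension `n + 1`** (iterate
`exists_merge₂_isBounded`): for a finite family `Aᵢ` of representations of dimension `n + 1` with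
bounded domains there is one such `K` with `∑ᵢ [Aᵢ] − [K] ∈ KZ.relations`.
[cite: ViuSos2021, Cor. 2.3] -/
theorem exists_merge_isBounded {n : ℕ} {ι : Type*} (s : Finset ι) (A : ι → KZ.IntegralRep (n + 1))
    (hc : ∀ i ∈ s, Bornology.IsBounded (A i).domain) :
    ∃ K : KZ.IntegralRep (n + 1), Bornology.IsBounded K.domain ∧
      ∑ i ∈ s, KZ.of (A i) - KZ.of K ∈ KZ.relations := by
  classical
  induction s using Finset.induction_on with
  | empty =>
    refine ⟨KZ.IntegralRep.empty _, Bornology.isBounded_empty, ?_⟩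
    simpa using KZ.relations.neg_mem KZ.IntegralRep.of_empty_mem_relations
  | insert a s ha ih =>
    obtain ⟨K', hK'c, hK'⟩ := ih fun i his => hc i (Finset.mem_insert_of_mem his)
    obtain ⟨K, hKc, hK⟩ :=
      exists_merge₂_isBounded (A a) K' (hc a (Finset.mem_insert_self a s)) hK'c
    refine ⟨K, hKc, ?_⟩
    rw [Finset.sum_insert ha]
    have : KZ.of (A a) + ∑ i ∈ s, KZ.of (A i) - KZ.of K = (∑ i ∈ s, KZ.of (A i) - KZ.of K') +
        (KZ.of (A a) + KZ.of K' - KZ.of K) := by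
      abel
    rw [this]
    exact KZ.relations.add_mem hK' hK

/-- **Bounded normal form in every positive dimension.** Every representation of dimension `n + 1` is
congruent modulo `KZ.relations` to ONE representation of the same dimension with bounded domain:
compactify by the charts of the projective line (`exists_sub_sum_isBounded_mem_relations`) and merge the
`2ⁿ⁺¹` bounded pieces by disjoint translates (`exists_merge_isBounded`).
[cite: ViuSos2021, Thm. 2.1] -/
theorem exists_isBounded_sub_mem_relations_succ {n : ℕ} (a : KZ.IntegralRep (n + 1)) :
    ∃ a' : KZ.IntegralRep (n + 1), Bornology.IsBounded a'.domain ∧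
      KZ.of a - KZ.of a' ∈ KZ.relations := by
  obtain ⟨R, hR, e⟩ := exists_sub_sum_isBounded_mem_relations a
  obtain ⟨K, hK, eK⟩ := exists_merge_isBounded Finset.univ R fun T _ => hR T
  refine ⟨K, hK, ?_⟩
  have : KZ.of a - KZ.of K = (KZ.of a - ∑ T, KZ.of (R T)) + (∑ T, KZ.of (R T) - KZ.of K) := by
    abel
  rw [this]
  exact KZ.relations.add_mem e eK

/-- **Merging inside a positive dimension** (stub `stub_sameDimMerge` of crux
stmt-KontsevichZagierPeriods-3498, line `registered`). Any two representations `a`, `b` of the same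
dimension `n + 1` — domains possibly unbounded — merge into one modulo `KZ.relations`:
`[a] + [b] − [c] ∈ KZ.relations` for some `c : KZ.IntegralRep (n + 1)`. Put both in bounded normal
form (`exists_isBounded_sub_mem_relations_succ`: split along the outer regions, rule (1); chart each
trace into `[-1, 1]ⁿ⁺¹` by a coordinate inversion, rule (2); translate apart and glue) and merge the two
bounded representations (`exists_merge₂_isBounded`: rule (2) translation along the first coordinate,
rule (1) gluing). [cite: KontsevichZagier2001, §1.2 rules (1)–(2)] -/
theorem stub_sameDimMerge : ∀ (n : ℕ) (a b : KZ.IntegralRep (n + 1)),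
    ∃ c : KZ.IntegralRep (n + 1), KZ.of a + KZ.of b - KZ.of c ∈ KZ.relations := by
  intro n a b
  obtain ⟨a', ha', ea⟩ := exists_isBounded_sub_mem_relations_succ a
  obtain ⟨b', hb', eb⟩ := exists_isBounded_sub_mem_relations_succ b
  obtain ⟨c, -, ec⟩ := exists_merge₂_isBounded a' b' ha' hb'
  refine ⟨c, ?_⟩
  have : KZ.of a + KZ.of b - KZ.of c =
      (KZ.of a - KZ.of a') + (KZ.of b - KZ.of b') + (KZ.of a' + KZ.of b' - KZ.of c) := by
    abel
  rw [this]
  exact KZ.relations.add_mem (KZ.relations.add_mem ea eb) ec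

end Summit.KontsevichZagierPeriods.ValuedFieldSpecialisation

end
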